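import Literature.NumberTheory.Automorphic.ArchEndoscopicChartOrbWeyl          -- ★ p849838 (LH2-p04): the swap `J` (`swapGL_inv`, …); brings the atlas (`endoTorus`, `endoBlock`, `P`)
import Literature.NumberTheory.Automorphic.ArchCartanStableSum                 -- ★ p849689 (LH3-p01): `flipSet`
import Literature.NumberTheory.Automorphic.ArchStableConjugacyLocalGlobal      -- ★ (g1): stable conjugacy in `U(H)(L⁺ ⊗ ℝ)` is checked place by place
import Literature.NumberTheory.Rogawski1990.ArchimedeanTransfer                -- ★ `IsArchStablyConjH`
import HarnessLib

/-!
# The flip classes of a chart point: stably conjugate, pairwise NOT conjugate in `H_∞` (the `H`-side class bookkeeping behind R4 (READ-H))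
# (Rogawski 1990 §3.1, §4.1, §8.2; Shelstad 1979 §4)

Topic `NumberTheory/Automorphic`; namespace `Literature.NumberTheory.Automorphic.UnitaryGroup`.  THEOREMS ONLY (no `def`, no instance, no notation, no axiom, no named
fact, no `sorry`).  Cell `pub/hodgecm-mathlib`, crux H413 (`stmt-HodgeConjecture-24833`), F0∕P3c line LH3 (closer stub `stub_N9`, DIRECT ROAD, organ `stub_N9read`);
discharges two of the three flagged hypotheses of R4 ED. 1 (LH2-p04 (g3) `ArchStableSideChartRead`, LH3-plan (g2) 2026-09-02T06:30:06Z): `hinj` (distinctness of the flip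
classes) and the «⊇» half of `hidx` (the flips ARE in the stable class).  Count-neutral.

THE MATHEMATICS.  Fix a chart `S` and coordinates `c`; for `T ⊆ univ ∖ S` the flip `flipSet T c` swaps the two compact angles `θ₀ ↔ θ₂` at the places of `T`
(★ p849689).  At such a place the `U(Φ₂)_w`-block `P·diag(e^{iθ₀}, e^{iθ₂})·P⁻¹` becomes `P·diag(e^{iθ₂}, e^{iθ₀})·P⁻¹`:
* §1 the two are conjugate in `GL₂(ℂ)` (by `P J P⁻¹`, `J = antidiag(1,1)`), so **`isArchStablyConjH_endoTorus_flipSet`**: `endoTorus S c ∼_st endoTorus S (flipSet T c)`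
  (★ (g1) place by place; the `U(Φ₁)`-component is untouched), and every flip CLASS lies in the stable class (`isArchStablyConjH_out_mk_endoTorus_flipSet`);
* §2 but NOT conjugate in `U(Φ₂)_w = U(1,1)` when `e^{iθ₀} ≠ e^{iθ₂}`: a `k ∈ U(Φ₂)` with `k·(P diag(u,v) P⁻¹)·k⁻¹ = P diag(v,u) P⁻¹` has the shape `(a b; −b −a)`, and then
  `(k̄ᵀ Φ₂ k)₀₁ = −(|a|² + |b|²) ≠ 1` — **`not_conj_cayley_swap`**; hence **`injOn_conjClassesMk_endoTorus_flipSet`**: for `c ∈ RegS S` the map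
  `T ↦ ⟦endoTorus S (flipSet T c)⟧` is injective on the subsets of `univ ∖ S` (an `H_∞`-conjugacy projects to a `U(Φ₂)_w`-conjugacy at a place `w ∈ T ∆ T′`).
NOT HERE: the «⊆» half of `hidx` (every class stably conjugate to `endoTorus S c` is a flip class — exhaustion inside the stable class) and `hbox` (frame box coherence).
HONEST LABEL: HC_CM is proved only modulo the 7 printed citations (2 remaining: hLiu418 = `stmt-HodgeConjecture-24832`, h413 = `stmt-HodgeConjecture-24833`) until rung 0 closes;
count-neutral.

## References
* [Rogawski1990] J. D. Rogawski, *Automorphic Representations of Unitary Groups in Three Variables*, Ann. of Math. Stud. 123 (1990), §3.1 p. 19 (stable conjugacy), §4.1 p. 39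
  (the classes inside a stable class), §8.2 p. 122 (the compact Cartan of `U(1,1)` in Cayley coordinates).
* [Shelstad1979] D. Shelstad, *Characters and inner forms of a quasi-split group over ℝ*, Compositio Math. 39 (1979), §4 pp. 22–23 (imaginary roots: the Weyl reflection is
  not realised in `G(ℝ)` for a compact root).
-/

set_option autoImplicit false

noncomputable section

open NumberField NumberField.InfinitePlace Matrix Complex Topology
open Literature.NumberTheory.Automorphic.ArchCartan
open scoped MatrixGroups Matrix ComplexConjugate Classical

namespace Literature.NumberTheory.Automorphic.UnitaryGroup

open Literature.NumberTheory.Rogawski1990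

/-! ## §1 The flips are stably conjugate -/

section Stable

/-- `J · diag(z₀, z₁) · J⁻¹ = diag(z₁, z₀)` for the swap `J = antidiag(1,1)`. [cite: Rogawski1990, §3.1 p. 19] -/
theorem swapGL_conj_circleDiagonal (z : Fin 2 → Circle) :
    Matrix.GeneralLinearGroup.mkOfDetNeZero !![(0 : ℂ), 1; 1, 0] det_swapTwo_ne_zero * circleDiagonal 2 z *
        (Matrix.GeneralLinearGroup.mkOfDetNeZero !![(0 : ℂ), 1; 1, 0] det_swapTwo_ne_zero)⁻¹ = circleDiagonal 2 ![z 1, z 0] := by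
  rw [swapGL_inv]
  refine Matrix.GeneralLinearGroup.ext fun i j => ?_
  rw [Units.val_mul, Units.val_mul, Matrix.GeneralLinearGroup.val_mkOfDetNeZero, coe_circleDiagonal, coe_circleDiagonal]
  simp only [Matrix.mul_apply, Fin.sum_univ_two, Matrix.diagonal_apply, Matrix.of_apply, Matrix.cons_val', Matrix.empty_val', Matrix.cons_val_fin_one,
    Matrix.cons_val_zero, Matrix.cons_val_one]
  fin_cases i <;> fin_cases j <;> simp

/-- **The Cayley blocks with swapped angles are conjugate in `GL₂(ℂ)`** (by `P J P⁻¹`). [cite: Rogawski1990, §3.1 p. 19; §8.2 p. 122] -/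
theorem isConj_cayley_conj_circleDiagonal_swap (z : Fin 2 → Circle) :
    IsConj (Matrix.GeneralLinearGroup.mkOfDetNeZero !![(1 : ℂ), 1; 1, -1] det_cayleyTwo_ne_zero * circleDiagonal 2 z *
        (Matrix.GeneralLinearGroup.mkOfDetNeZero !![(1 : ℂ), 1; 1, -1] det_cayleyTwo_ne_zero)⁻¹)
      (Matrix.GeneralLinearGroup.mkOfDetNeZero !![(1 : ℂ), 1; 1, -1] det_cayleyTwo_ne_zero * circleDiagonal 2 ![z 1, z 0] *
        (Matrix.GeneralLinearGroup.mkOfDetNeZero !![(1 : ℂ), 1; 1, -1] det_cayleyTwo_ne_zero)⁻¹) := by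
  refine isConj_iff.2 ⟨Matrix.GeneralLinearGroup.mkOfDetNeZero !![(1 : ℂ), 1; 1, -1] det_cayleyTwo_ne_zero *
    Matrix.GeneralLinearGroup.mkOfDetNeZero !![(0 : ℂ), 1; 1, 0] det_swapTwo_ne_zero *
    (Matrix.GeneralLinearGroup.mkOfDetNeZero !![(1 : ℂ), 1; 1, -1] det_cayleyTwo_ne_zero)⁻¹, ?_⟩
  rw [← swapGL_conj_circleDiagonal z]
  group

variable (L : Type) [Field L] [NumberField L] [IsCMField L] (S : Finset {w : InfinitePlace L // IsComplex w})

omit [NumberField L] [IsCMField L] in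
/-- GL-level reading of the `U(Φ₂)_w`-block at a compact place. [cite: Rogawski1990, §8.2 p. 122] -/
private theorem coe_endoBlock_GL_of_not_mem {w : {w : InfinitePlace L // IsComplex w}} (hwS : w ∉ S) (c : {w : InfinitePlace L // IsComplex w} → Fin 3 → ℝ) :
    ((endoBlock L S c w : ↥(archLocal L 2 (Matrix.of fun i j : Fin 2 => if i.val + j.val + 1 = 2 then (1 : L) else 0) w)) : GL (Fin 2) ℂ) =
      Matrix.GeneralLinearGroup.mkOfDetNeZero !![(1 : ℂ), 1; 1, -1] det_cayleyTwo_ne_zero * circleDiagonal 2 ![Circle.exp (c w 0), Circle.exp (c w 2)] *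
        (Matrix.GeneralLinearGroup.mkOfDetNeZero !![(1 : ℂ), 1; 1, -1] det_cayleyTwo_ne_zero)⁻¹ := by
  unfold endoBlock
  rw [if_neg hwS]

omit [NumberField L] [IsCMField L] in
/-- The same at a flipped place: the angles are swapped. [cite: Shelstad1979, §4 p. 23] -/
private theorem coe_endoBlock_GL_flipSet_of_mem {T : Finset {w : InfinitePlace L // IsComplex w}} {w : {w : InfinitePlace L // IsComplex w}} (hwS : w ∉ S) (hw : w ∈ T)
    (c : {w : InfinitePlace L // IsComplex w} → Fin 3 → ℝ) :
    ((endoBlock L S (flipSet T c) w : ↥(archLocal L 2 (Matrix.of fun i j : Fin 2 => if i.val + j.val + 1 = 2 then (1 : L) else 0) w)) : GL (Fin 2) ℂ) =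
      Matrix.GeneralLinearGroup.mkOfDetNeZero !![(1 : ℂ), 1; 1, -1] det_cayleyTwo_ne_zero * circleDiagonal 2 ![Circle.exp (c w 2), Circle.exp (c w 0)] *
        (Matrix.GeneralLinearGroup.mkOfDetNeZero !![(1 : ℂ), 1; 1, -1] det_cayleyTwo_ne_zero)⁻¹ := by
  rw [coe_endoBlock_GL_of_not_mem L S hwS, flipSet_apply_of_mem hw]
  rfl

omit [NumberField L] [IsCMField L] in
/-- `flipSet` leaves the `U(Φ₁)`-coordinate alone: `endoCircle (flipSet T c) = endoCircle c`. [cite: Shelstad1979, §4 p. 23] -/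
theorem endoCircle_flipSet (T : Finset {w : InfinitePlace L // IsComplex w}) (c : {w : InfinitePlace L // IsComplex w} → Fin 3 → ℝ) :
    endoCircle L (flipSet T c) = endoCircle L c := by
  funext w
  apply Subtype.ext
  apply Units.ext
  rw [coe_endoCircle, coe_endoCircle]
  by_cases hw : w ∈ T
  · rw [flipSet_apply_of_mem hw]; rfl
  · rw [flipSet_apply_of_not_mem hw]

/-- **FLIPS ARE STABLY CONJUGATE**: for `T ⊆ univ ∖ S`, `endoTorus S c ∼_st endoTorus S (flipSet T c)` in `H_∞` (place by place, ★ (g1): at `w ∈ T` the Cayley blocks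
with swapped angles are `GL₂(ℂ)`-conjugate, elsewhere the blocks agree; the `U(Φ₁)`-component is unchanged). [cite: Rogawski1990, §3.1 p. 19; §4.1 p. 39] [cite: Shelstad1979, §4 p. 23] -/
theorem isArchStablyConjH_endoTorus_flipSet {T : Finset {w : InfinitePlace L // IsComplex w}} (hT : ∀ w ∈ T, w ∉ S)
    (c : {w : InfinitePlace L // IsComplex w} → Fin 3 → ℝ) :
    IsArchStablyConjH L (endoTorus L S c) (endoTorus L S (flipSet T c)) := by
  refine ⟨?_, ?_⟩
  · -- the `U(Φ₂)` component, place by place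
    rw [isStablyConj_arch_iff_forall_place]
    intro w
    show IsConj _ _
    rw [archPiEquivCM_endoTorus_fst, archPiEquivCM_endoTorus_fst]
    by_cases hw : w ∈ T
    · have hwS : w ∉ S := hT w hw
      rw [coe_endoBlock_GL_of_not_mem L S hwS c, coe_endoBlock_GL_flipSet_of_mem L S hwS hw c]
      exact isConj_cayley_conj_circleDiagonal_swap ![Circle.exp (c w 0), Circle.exp (c w 2)]
    · have h : endoBlock L S (flipSet T c) w = endoBlock L S c w := by
        apply Subtype.ext; apply Units.ext
        by_cases hwS : w ∈ S
        · rw [coe_endoBlock_of_mem L _ hwS, coe_endoBlock_of_mem L _ hwS, flipSet_apply_of_not_mem hw]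
        · rw [coe_endoBlock_of_not_mem L _ hwS, coe_endoBlock_of_not_mem L _ hwS, flipSet_apply_of_not_mem hw]
      rw [h]
  · -- the `U(Φ₁)` component is unchanged
    have h : (endoTorus L S (flipSet T c)).2 = (endoTorus L S c).2 := by
      unfold endoTorus; simp only; rw [endoCircle_flipSet]
    rw [h]
    exact IsStablyConj.refl _

/-- **Every flip CLASS lies in the stable class of `endoTorus S c`** (the representative `out ⟦·⟧` is conjugate, hence stably conjugate, to the flip point).
[cite: Rogawski1990, §4.1 p. 39] -/
theorem isArchStablyConjH_out_mk_endoTorus_flipSet {T : Finset {w : InfinitePlace L // IsComplex w}} (hT : ∀ w ∈ T, w ∉ S)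
    (c : {w : InfinitePlace L // IsComplex w} → Fin 3 → ℝ) :
    IsArchStablyConjH L (endoTorus L S c) (Quotient.out (ConjClasses.mk (endoTorus L S (flipSet T c)) :
      ConjClasses (↥(arch (↥(maximalRealSubfield L)) L (IsCMField.complexConj L) 2 (Matrix.of fun i j : Fin 2 => if i.val + j.val + 1 = 2 then (1 : L) else 0)) ×
        ↥(arch (↥(maximalRealSubfield L)) L (IsCMField.complexConj L) 1 (Matrix.of fun i j : Fin 1 => if i.val + j.val + 1 = 1 then (1 : L) else 0))))) := by
  have hconj : IsConj (endoTorus L S (flipSet T c)) (Quotient.out (ConjClasses.mk (endoTorus L S (flipSet T c)) : ConjClasses _)) := by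
    rw [← ConjClasses.mk_eq_mk_iff_isConj, ConjClasses.mk, ConjClasses.mk, Quotient.out_eq]
  exact (isArchStablyConjH_endoTorus_flipSet L S hT c).trans (isStablyConjH_of_isConj hconj)

end Stable

/-! ## §2 The flips are pairwise NOT conjugate in `H_∞` -/

section NotConj

variable (L : Type) [Field L] (w : {w : InfinitePlace L // IsComplex w})

/-- **NO ELEMENT OF `U(Φ₂) = U(1,1)` SWAPS THE TWO CAYLEY EIGENLINES**: for unit `u ≠ v`, no `k ∈ U(Φ₂)_w` conjugates `P·diag(u,v)·P⁻¹` to `P·diag(v,u)·P⁻¹`.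
(From `k·A = A′·k` with `A = ½(u+v, u−v; u−v, u+v)`, `A′ = ½(u+v, v−u; v−u, u+v)`: `k = (a b; −b −a)`; then `(k̄ᵀ Φ₂ k)₀₁ = −(|a|² + |b|²) = 1` is absurd — the `u`-line is
positive and the `v`-line negative for the hermitian form.) [cite: Shelstad1979, §4 pp. 22–23] [cite: Rogawski1990, §8.2 p. 122] -/
theorem not_conj_cayley_swap {u v : Circle} (huv : u ≠ v)
    (k : ↥(archLocal L 2 (Matrix.of fun i j : Fin 2 => if i.val + j.val + 1 = 2 then (1 : L) else 0) w)) :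
    (k : GL (Fin 2) ℂ) * (Matrix.GeneralLinearGroup.mkOfDetNeZero !![(1 : ℂ), 1; 1, -1] det_cayleyTwo_ne_zero * circleDiagonal 2 ![u, v] *
        (Matrix.GeneralLinearGroup.mkOfDetNeZero !![(1 : ℂ), 1; 1, -1] det_cayleyTwo_ne_zero)⁻¹) * (k : GL (Fin 2) ℂ)⁻¹ ≠
      Matrix.GeneralLinearGroup.mkOfDetNeZero !![(1 : ℂ), 1; 1, -1] det_cayleyTwo_ne_zero * circleDiagonal 2 ![v, u] *
        (Matrix.GeneralLinearGroup.mkOfDetNeZero !![(1 : ℂ), 1; 1, -1] det_cayleyTwo_ne_zero)⁻¹ := by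
  intro h
  -- the matrix equation `K A = A′ K`
  set X : GL (Fin 2) ℂ := Matrix.GeneralLinearGroup.mkOfDetNeZero !![(1 : ℂ), 1; 1, -1] det_cayleyTwo_ne_zero * circleDiagonal 2 ![u, v] *
    (Matrix.GeneralLinearGroup.mkOfDetNeZero !![(1 : ℂ), 1; 1, -1] det_cayleyTwo_ne_zero)⁻¹ with hX
  set Y : GL (Fin 2) ℂ := Matrix.GeneralLinearGroup.mkOfDetNeZero !![(1 : ℂ), 1; 1, -1] det_cayleyTwo_ne_zero * circleDiagonal 2 ![v, u] *
    (Matrix.GeneralLinearGroup.mkOfDetNeZero !![(1 : ℂ), 1; 1, -1] det_cayleyTwo_ne_zero)⁻¹ with hY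
  have h' : (k : GL (Fin 2) ℂ) * X = Y * (k : GL (Fin 2) ℂ) := by
    calc (k : GL (Fin 2) ℂ) * X = (k : GL (Fin 2) ℂ) * X * (k : GL (Fin 2) ℂ)⁻¹ * (k : GL (Fin 2) ℂ) := by group
      _ = Y * (k : GL (Fin 2) ℂ) := by rw [h]
  have hXm : (X : Matrix (Fin 2) (Fin 2) ℂ) = !![((u : ℂ) + v) / 2, ((u : ℂ) - v) / 2; ((u : ℂ) - v) / 2, ((u : ℂ) + v) / 2] := by
    rw [hX]; exact coe_cayley_conj_circleDiagonal ![u, v]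
  have hYm : (Y : Matrix (Fin 2) (Fin 2) ℂ) = !![((v : ℂ) + u) / 2, ((v : ℂ) - u) / 2; ((v : ℂ) - u) / 2, ((v : ℂ) + u) / 2] := by
    rw [hY]; exact coe_cayley_conj_circleDiagonal ![v, u]
  have hKA : ((k : GL (Fin 2) ℂ) : Matrix (Fin 2) (Fin 2) ℂ) *
      !![((u : ℂ) + v) / 2, ((u : ℂ) - v) / 2; ((u : ℂ) - v) / 2, ((u : ℂ) + v) / 2] =
      !![((v : ℂ) + u) / 2, ((v : ℂ) - u) / 2; ((v : ℂ) - u) / 2, ((v : ℂ) + u) / 2] * ((k : GL (Fin 2) ℂ) : Matrix (Fin 2) (Fin 2) ℂ) := by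
    have h'' := congrArg (fun g : GL (Fin 2) ℂ => (g : Matrix (Fin 2) (Fin 2) ℂ)) h'
    simp only [Units.val_mul] at h''
    rwa [hXm, hYm] at h''
  -- unitarity of `k`
  have hU := k.2
  rw [mem_archLocal_iff, Literature.NumberTheory.Rogawski1990.antidiagOne_map (w.1.embedding) 2] at hU
  set K : Matrix (Fin 2) (Fin 2) ℂ := ((k : GL (Fin 2) ℂ) : Matrix (Fin 2) (Fin 2) ℂ) with hK
  have huv' : (u : ℂ) - v ≠ 0 := sub_ne_zero.2 fun e => huv (Subtype.ext e)
  -- read the shape `K = (a b; −b −a)` off `K A = A′ K`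
  have e00 := congrFun (congrFun hKA 0) 0
  have e01 := congrFun (congrFun hKA 0) 1
  simp [Matrix.mul_apply, Fin.sum_univ_two] at e00 e01
  have h11 : K 1 1 = -K 0 0 := by
    have : (K 0 0 + K 1 1) * ((u : ℂ) - v) = 0 := by linear_combination (2 : ℂ) * e01
    have h2 := (mul_eq_zero.1 this).resolve_right huv'
    linear_combination h2
  have h10 : K 1 0 = -K 0 1 := by
    have : (K 0 1 + K 1 0) * ((u : ℂ) - v) = 0 := by linear_combination (2 : ℂ) * e00
    have h2 := (mul_eq_zero.1 this).resolve_right huv'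
    linear_combination h2
  -- entry `(0,1)` of `K̄ᵀ Φ₂ K = Φ₂`: `conj(K00) K11 + conj(K10) K01 = 1`
  have e := congrFun (congrFun hU 0) 1
  simp [Matrix.mul_apply, Fin.sum_univ_two] at e
  rw [h11, h10] at e
  -- `−(|K00|² + |K01|²) = 1` is absurd
  rw [map_neg, mul_neg, neg_mul, Complex.conj_mul', Complex.conj_mul'] at e
  have hre : -(‖K 0 1‖ ^ 2) + -(‖K 0 0‖ ^ 2) = (1 : ℝ) := by exact_mod_cast e
  nlinarith [sq_nonneg ‖K 0 0‖, sq_nonneg ‖K 0 1‖]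

variable [NumberField L] [IsCMField L] (S : Finset {w : InfinitePlace L // IsComplex w})

/-- **THE FLIP CLASSES ARE PAIRWISE DISTINCT** (the `hinj` of R4): for `c ∈ RegS S`, `T ↦ ⟦endoTorus S (flipSet T c)⟧` is injective on the subsets of `univ ∖ S`
— an `H_∞`-conjugacy between two flips, read at a place `w ∈ T ∆ T′` through ★ `archPiEquivCM`, would be a `U(Φ₂)_w`-conjugacy swapping the Cayley eigenlines
(`not_conj_cayley_swap`). [cite: Rogawski1990, §4.1 p. 39; §8.2 p. 122] [cite: Shelstad1979, §4 pp. 22–23] -/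
theorem injOn_conjClassesMk_endoTorus_flipSet {c : {w : InfinitePlace L // IsComplex w} → Fin 3 → ℝ} (hc : c ∈ ArchCartan.RegS S) :
    Set.InjOn (fun T : Finset {w : InfinitePlace L // IsComplex w} =>
      (ConjClasses.mk (endoTorus L S (flipSet T c)) :
        ConjClasses (↥(arch (↥(maximalRealSubfield L)) L (IsCMField.complexConj L) 2 (Matrix.of fun i j : Fin 2 => if i.val + j.val + 1 = 2 then (1 : L) else 0)) ×
          ↥(arch (↥(maximalRealSubfield L)) L (IsCMField.complexConj L) 1 (Matrix.of fun i j : Fin 1 => if i.val + j.val + 1 = 1 then (1 : L) else 0)))))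
      (↑((Finset.univ \ S).powerset) : Set (Finset {w : InfinitePlace L // IsComplex w})) := by
  intro T hT T' hT' hTT'
  have hTS : ∀ w ∈ T, w ∉ S := not_mem_of_mem_powerset_sdiff (Finset.mem_coe.1 hT)
  have hT'S : ∀ w ∈ T', w ∉ S := not_mem_of_mem_powerset_sdiff (Finset.mem_coe.1 hT')
  by_contra hne
  -- a place where the two flips differ; by symmetry of conjugacy we may assume `w ∈ T`, `w ∉ T′`
  have key : ∀ (T₁ T₂ : Finset {w : InfinitePlace L // IsComplex w}), (∀ w ∈ T₁, w ∉ S) → (∀ w ∈ T₂, w ∉ S) →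
      IsConj (endoTorus L S (flipSet T₁ c)) (endoTorus L S (flipSet T₂ c)) → ∀ w, w ∈ T₁ → w ∉ T₂ → False := by
    intro T₁ T₂ h₁ h₂ hconj w hw₁ hw₂
    obtain ⟨x, hx⟩ := isConj_iff.1 hconj
    have hwS : w ∉ S := h₁ w hw₁
    -- read the conjugacy at the place `w` of the `U(Φ₂)` component
    have h1 := congrArg (fun g => archPiEquivCM 2 L (Matrix.of fun i j : Fin 2 => if i.val + j.val + 1 = 2 then (1 : L) else 0) g.1 w) hx
    simp only [Prod.fst_mul, Prod.fst_inv, map_mul, map_inv, Pi.mul_apply, Pi.inv_apply, archPiEquivCM_endoTorus_fst] at h1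
    have hA := coe_endoBlock_GL_flipSet_of_mem L S hwS hw₁ c
    have hB : ((endoBlock L S (flipSet T₂ c) w : ↥(archLocal L 2 _ w)) : GL (Fin 2) ℂ) =
        Matrix.GeneralLinearGroup.mkOfDetNeZero !![(1 : ℂ), 1; 1, -1] det_cayleyTwo_ne_zero * circleDiagonal 2 ![Circle.exp (c w 0), Circle.exp (c w 2)] *
          (Matrix.GeneralLinearGroup.mkOfDetNeZero !![(1 : ℂ), 1; 1, -1] det_cayleyTwo_ne_zero)⁻¹ := by
      rw [coe_endoBlock_GL_of_not_mem L S hwS, flipSet_apply_of_not_mem hw₂]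
    have h2 := congrArg (fun g : ↥(archLocal L 2 (Matrix.of fun i j : Fin 2 => if i.val + j.val + 1 = 2 then (1 : L) else 0) w) => (g : GL (Fin 2) ℂ)) h1
    simp only [Subgroup.coe_mul, Subgroup.coe_inv, hA, hB] at h2
    have hne' : Circle.exp (c w 2) ≠ Circle.exp (c w 0) := fun e => ((ArchCartan.mem_regS_iff S c).1 hc).1 w hwS e.symm
    exact not_conj_cayley_swap L w hne' _ h2
  have hconj : IsConj (endoTorus L S (flipSet T c)) (endoTorus L S (flipSet T' c)) := ConjClasses.mk_eq_mk_iff_isConj.1 hTT'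
  -- `T ≠ T′`: some place lies in exactly one of them
  obtain ⟨w, hw⟩ : ∃ w, (w ∈ T ∧ w ∉ T') ∨ (w ∈ T' ∧ w ∉ T) := by
    by_contra hall
    push Not at hall
    exact hne (Finset.ext fun w => ⟨(hall w).1, (hall w).2⟩)
  rcases hw with ⟨h1, h2⟩ | ⟨h1, h2⟩
  · exact key T T' hTS hT'S hconj w h1 h2
  · exact key T' T hT'S hTS hconj.symm w h1 h2

end NotConj

end Literature.NumberTheory.Automorphic.UnitaryGroup

end
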